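import Summits.CriticalPhenomena.PercolationContinuityZ3.Theorems.SahiMasterFamilyPhiSymmetric

/-!
# `F(k)` is false for EVERY `k ≥ 16`: branching in `Φ`-form

Unit `prim-masterthm-p4` (gen 15; crux anchor stmt-CriticalPhenomena-4575, helper work; memo
`run/shared/lean/prim/prim-masterthm/prim-masterthm-p4/P4-GEN15-REPORT.md` §1).  Companion of `…PhiSymmetric`
(`not_phiNonneg_sixteen`: the abstract relaxation `PhiNonneg 16` = "`F(16)`" fails at an explicit symmetric parity point).

* `phiSet_pullback` (every order): for a set function `β` on `Fin (k+1)` with `β ∅ = 1`, the pull-back `β'(T) := β{i : castSucc i ∈ T}` to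
  `Fin (k+2)` (the new last index is FREE) has **`Φ_{k+2}(β') = k·Φ_{k+1}(β)`** — Sahi's branching identity `E_n(f_1,…,f_{n−1},1) = (n−2)·E_{n−1}`
  [Sahi2008, Thm. 6] (tree: `sahiE_snoc_one`) read in the canonical signed model `realW β'` of `…PrincipalCapBetaSmall`, whose total mass is
  `β' ∅ = 1` (`sum_realW`) and under which the coordinate family `realF` and the family "`realF` with the last slot replaced by `1`" have the same
  moment function (`Φ` depends on moments only, `PrincipalCapBeta.sahiE_eq_phiSet`).
* `exists_bad_succ`, `exists_bad`: feasibility (`[0,1]`-valued, top `1`, supermultiplicative under unions, `β ∅ = 1`) and `Φ < 0` lift one order up,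
  starting from the order-16 witness of `…PhiSymmetric`.
* **`not_phiNonneg_of_sixteen_le : 16 ≤ k → ¬ PhiNonneg k`.**

HONEST FRAMING: this refutes the RELAXATION `F(k)` (box + top + supermultiplicativity), not Sahi's `C_k` nor the principal-cap statement PC-k (event
families satisfy the one-missing-face inequalities `Σ_{i∈B} β_{B∖i} ≤ 1 + (|B|−1)β_B`, which every branched witness violates; memo §2).  Sahi's `C_k`,
Kahn's Conjecture 5 and the master theorem remain OPEN.  Axioms standard. [this work]
-/

noncomputable section

open scoped Classical

namespace Summit.CriticalPhenomena.PercolationContinuityZ3.Theorems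

namespace PhiSymmetricLift

open Finset Function
open Literature.Combinatorics.Sahi2008
open Literature.Combinatorics.Sahi2008.CycleForm
open PrincipalCapBeta (phiSet realF realW)

variable {k : ℕ}

/-! ### Branching in `Φ`-form: adding a free index multiplies `Φ` by `k` -/

/-- The canonical signed model of `β` has total mass `β ∅`. [this work] -/
theorem sum_realW (β : Finset (Fin k) → ℝ) : ∑ x, realW β x = β ∅ := by
  have h := PrincipalCapBeta.ex_realW_prod β ∅
  rw [prod_empty] at h
  rw [← h, ex_def]
  simp only [Pi.one_apply, mul_one]

/-- The pull-back of `T ⊆ Fin (k+2)` to `Fin (k+1)` along `castSucc` ignores the last index. [folklore] -/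
theorem filter_castSucc_mem_erase (T : Finset (Fin (k + 2))) :
    (univ.filter fun i : Fin (k + 1) => Fin.castSucc i ∈ T.erase (Fin.last (k + 1))) =
      univ.filter fun i : Fin (k + 1) => Fin.castSucc i ∈ T := by
  ext i
  simp only [mem_filter, mem_univ, true_and, mem_erase, ne_eq, Fin.castSucc_ne_last, not_false_eq_true, true_and]

/-- The pull-back of an image is the set itself. [folklore] -/
theorem filter_castSucc_mem_map (S : Finset (Fin (k + 1))) :
    (univ.filter fun i : Fin (k + 1) => Fin.castSucc i ∈ S.map Fin.castSuccEmb) = S := by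
  ext i
  simp only [mem_filter, mem_univ, true_and, mem_map]
  constructor
  · rintro ⟨j, hj, hji⟩
    have : j = i := Fin.castSucc_injective _ (by simpa using hji)
    exact this ▸ hj
  · intro hi; exact ⟨i, hi, rfl⟩

/-- **Branching in `Φ`-form (every order).**  For a set function `β` on `Fin (k+1)` with `β ∅ = 1`, its pull-back to `Fin (k+2)` IGNORING the new
last index, `β'(T) := β{i : castSucc i ∈ T}`, has `Φ_{k+2}(β') = k·Φ_{k+1}(β)` — Sahi's `E_n(f_1,…,f_{n−1},1) = (n−2)E_{n−1}` [Sahi2008, Thm. 6]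
read in the canonical signed model (`sahiE_snoc_one`; both families have the moment function `β'`). [this work] -/
theorem phiSet_pullback (β : Finset (Fin (k + 1)) → ℝ) (h0 : β ∅ = 1) :
    phiSet (k + 2) (fun T : Finset (Fin (k + 2)) => β (univ.filter fun i : Fin (k + 1) => Fin.castSucc i ∈ T)) =
      (k : ℝ) * phiSet (k + 1) β := by
  set β' : Finset (Fin (k + 2)) → ℝ := fun T => β (univ.filter fun i : Fin (k + 1) => Fin.castSucc i ∈ T) with hβ'
  set μ := realW β' with hμ
  have hμ1 : ∑ x, μ x = 1 := by
    rw [hμ, sum_realW, hβ']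
    simp only [notMem_empty, filter_false]
    exact h0
  set g : Fin (k + 1) → Finset (Fin (k + 2)) → ℝ := fun j => realF j.castSucc with hg
  -- the two families `realF` and `snoc g 1` have the same moments under `μ`
  have hmom : ∀ B : Finset (Fin (k + 2)),
      ex μ (∏ x ∈ B, (Fin.snoc g 1 : Fin (k + 2) → Finset (Fin (k + 2)) → ℝ) x) = ex μ (∏ x ∈ B, realF x) := by
    intro B
    have e1 : (∏ x ∈ B, (Fin.snoc g 1 : Fin (k + 2) → Finset (Fin (k + 2)) → ℝ) x) =
        ∏ x ∈ B.erase (Fin.last (k + 1)), (realF x : Finset (Fin (k + 2)) → ℝ) := by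
      by_cases hl : Fin.last (k + 1) ∈ B
      · rw [← prod_erase_mul B _ hl, Fin.snoc_last, mul_one]
        refine prod_congr rfl fun x hx => ?_
        have hx' : x ≠ Fin.last (k + 1) := (mem_erase.1 hx).1
        obtain ⟨j, rfl⟩ := Fin.exists_castSucc_eq.2 hx'
        rw [Fin.snoc_castSucc]
      · rw [erase_eq_of_notMem hl]
        refine prod_congr rfl fun x hx => ?_
        have hx' : x ≠ Fin.last (k + 1) := fun h => hl (h ▸ hx)
        obtain ⟨j, rfl⟩ := Fin.exists_castSucc_eq.2 hx'
        rw [Fin.snoc_castSucc]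
    rw [e1, hμ, PrincipalCapBeta.ex_realW_prod, PrincipalCapBeta.ex_realW_prod, hβ']
    simp only [filter_castSucc_mem_erase]
  have hE : sahiE μ (k + 2) realF = sahiE μ (k + 2) (Fin.snoc g 1 : Fin (k + 2) → Finset (Fin (k + 2)) → ℝ) := by
    rw [PrincipalCapBeta.sahiE_eq_phiSet, PrincipalCapBeta.sahiE_eq_phiSet]
    congr 1
    funext B
    exact (hmom B).symm
  rw [PrincipalCapBeta.phiSet_eq_sahiE_real, ← hμ, hE, sahiE_snoc_one hμ1, PrincipalCapBeta.sahiE_eq_phiSet]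
  congr 1
  congr 1
  funext S
  rw [hg, hμ, PrincipalCapStep.ex_prod_realF_castSucc, hβ']
  simp only [filter_castSucc_mem_map]

/-! ### `F(k)` is false for every `k ≥ 16` -/

/-- A feasible point with `β ∅ = 1` and negative `Φ` lifts one order up. [this work] -/
theorem exists_bad_succ (β : Finset (Fin (k + 1)) → ℝ) (h0 : ∀ B, 0 ≤ β B) (h1 : ∀ B, β B ≤ 1) (huniv : β univ = 1)
    (hsup : ∀ S T, β S * β T ≤ β (S ∪ T)) (hempty : β ∅ = 1) (hneg : phiSet (k + 1) β < 0) (hk : 1 ≤ k) :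
    ∃ β' : Finset (Fin (k + 2)) → ℝ, (∀ B, 0 ≤ β' B) ∧ (∀ B, β' B ≤ 1) ∧ β' univ = 1 ∧
      (∀ S T, β' S * β' T ≤ β' (S ∪ T)) ∧ β' ∅ = 1 ∧ phiSet (k + 2) β' < 0 := by
  refine ⟨fun T => β (univ.filter fun i : Fin (k + 1) => Fin.castSucc i ∈ T), fun B => h0 _, fun B => h1 _, ?_, ?_, ?_, ?_⟩
  · simp only [mem_univ, filter_true]
    exact huniv
  · intro S T
    have e : (univ.filter fun i : Fin (k + 1) => Fin.castSucc i ∈ S ∪ T) =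
        (univ.filter fun i : Fin (k + 1) => Fin.castSucc i ∈ S) ∪ univ.filter fun i : Fin (k + 1) => Fin.castSucc i ∈ T := by
      ext i; simp only [mem_filter, mem_univ, true_and, mem_union]
    simp only [e]
    exact hsup _ _
  · simp only [notMem_empty, filter_false]
    exact hempty
  · rw [phiSet_pullback β hempty]
    have hkpos : (0 : ℝ) < k := by exact_mod_cast hk
    exact mul_neg_of_pos_of_neg hkpos hneg

/-- Feasible points with negative `Φ` exist at every order `j + 16`. [this work] -/
theorem exists_bad (j : ℕ) : ∃ β : Finset (Fin (j + 15 + 1)) → ℝ, (∀ B, 0 ≤ β B) ∧ (∀ B, β B ≤ 1) ∧ β univ = 1 ∧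
    (∀ S T, β S * β T ≤ β (S ∪ T)) ∧ β ∅ = 1 ∧ phiSet (j + 15 + 1) β < 0 := by
  induction j with
  | zero =>
    refine ⟨fun S : Finset (Fin 16) => PhiSymmetric.f16 S.card, fun B => PhiSymmetric.f16_nonneg _,
      fun B => PhiSymmetric.f16_le_one _, PhiSymmetric.f16_univ, PhiSymmetric.f16_supermul, ?_, ?_⟩
    · show PhiSymmetric.f16 (∅ : Finset (Fin 16)).card = 1
      rw [card_empty]; norm_num [PhiSymmetric.f16, PhiSymmetric.symProfile]
    · have hfold : phiSet 16 (fun S : Finset (Fin 16) => PhiSymmetric.f16 S.card) = PhiSymmetric.phiSym PhiSymmetric.f16 16 := rfl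
      show phiSet 16 (fun S : Finset (Fin 16) => PhiSymmetric.f16 S.card) < 0
      rw [hfold, PhiSymmetric.phiSym_f16_sixteen]
      norm_num
  | succ j ih =>
    obtain ⟨β, h0, h1, huniv, hsup, hempty, hneg⟩ := ih
    have h := exists_bad_succ β h0 h1 huniv hsup hempty hneg (by omega)
    have e : j + 1 + 15 = j + 15 + 1 := by omega
    rw [e]
    exact h

/-- **`F(k)` IS FALSE FOR EVERY `k ≥ 16`**: the abstract relaxation `PhiNonneg k` fails from order sixteen on (the order-16 parity witness,
branched). Sahi's `C_k` and the principal-cap statement PC-k are NOT refuted by this (memo §2). [this work] -/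
theorem not_phiNonneg_of_sixteen_le (hk : 16 ≤ k) : ¬ PrincipalCapBeta.PhiNonneg k := by
  obtain ⟨j, rfl⟩ := Nat.exists_eq_add_of_le' hk
  obtain ⟨β, h0, h1, huniv, hsup, -, hneg⟩ := exists_bad j
  intro h
  exact absurd (h β h0 h1 huniv hsup) (not_le.2 hneg)

end PhiSymmetricLift

end Summit.CriticalPhenomena.PercolationContinuityZ3.Theorems
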